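import Literature.Computability.Cryptography.ShorProofs
import Literature.NumberTheory.LFunctions.MertensElementary
import HarnessLib

/-!
# Shor's factoring theorem: discharge of the totient bound `φ(r)/r > δ / log log r`

Sibling proofs file of `Literature/Computability/Cryptography/ShorProofs.lean` (which stays a
definitions/named-facts file). It discharges the named fact
`Literature.Computability.Cryptography.Shor1997_totient_lower_bound` used by Shor (1997, §5, p. 14 of arXiv v2: "using the
theorem that `φ(r)/r > δ / log log r` for some constant `δ` [Hardy and Wright 1979,
Theorem 328]"; Hardy–Wright Thm 328 is `liminf φ(n) log log n / n = e^{-γ}`). Only the weak,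
explicit form is needed, and it is proved in the tree from Chebyshev's bound and Legendre's
formula in `Literature/NumberTheory/LFunctions/MertensElementary.lean` (Mertens I/II upper
halves, `∏_{p ≤ N} (1 - 1/p) ≥ e^{-5}/log N`, whence `φ(n)/n ≥ e^{-5}/(2 log log n)` for
`n ≥ 3^9`, the finitely many smaller `n ≥ 3` being absorbed into the constant):
`Literature.NumberTheory.LFunctions.MertensBound.exists_lt_totient_div_self` is literally the statement.

## References

* P. W. Shor, *Polynomial-time algorithms for prime factorization and discrete logarithms on a
  quantum computer*, SIAM J. Comput. 26 (1997) 1484–1509 (= arXiv:quant-ph/9508027v2), §5,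
  p. 14 of the arXiv version [Shor1997].
* G. H. Hardy, E. M. Wright, *An Introduction to the Theory of Numbers*, 6th ed., OUP 2008,
  Thm 328 (§18.4, p. 352 of the 6th ed.; `liminf φ(n) log log n / n = e^{-γ}`) [HardyWright2008].
-/

noncomputable section

namespace Literature.Computability.Cryptography

/-- **Discharge of the totient lower bound** `Shor1997_totient_lower_bound`
(`∃ δ > 0, ∀ r ≥ 3, δ / log log r < φ(r)/r`; Shor 1997, §5, p. 14 of arXiv v2, citing
Hardy–Wright Thm 328): it is `Literature.NumberTheory.LFunctions.MertensBound.exists_lt_totient_div_self`.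
[cite: HardyWright2008, Thm 328 (§18.4); as used in Shor1997 §5] -/
theorem Shor1997_totient_lower_bound_holds : Shor1997_totient_lower_bound :=
  Literature.NumberTheory.LFunctions.MertensBound.exists_lt_totient_div_self

end Literature.Computability.Cryptography

end
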